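import Summits.CriticalPhenomena.PercolationContinuityZ3.Theorems.PercNearOneGluingNoHeavyConstsSingleEdgeValue
import Summits.CriticalPhenomena.PercolationContinuityZ3.Theorems.PercNearOneGluingNoHeavyConstsJointObsLeSingleEdge
import Summits.CriticalPhenomena.PercolationContinuityZ3.Theorems.PercNearOneGluingNoHeavyConstsMDLXJointImpliesMDLX
import HarnessLib

/-!
# CONJECTURE "single-edge extremality": the sharp observer constant of MDL(X) is the single-pair value `p⋆` — statement and
# kernel consequences (PAPER-2 track (ii): constants of the CSH family)

builds on p205010 (kernel theorem, internal audit signed; external expert review pending).  Support file (`--supports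
stmt-CriticalPhenomena-4575`), seat `prim-consts-2`; rows A6/A11 of `run/shared/lean/prim/consts/CONSTANTS.md`; prim-paper-s3 finding F7
(`FROM-prim-paper-s3-g70-SINGLE-EDGE-EXTREMALITY.md`, conjecture SEE of F7.3).  One `Prop` definition (an OPEN statement, tagged `@[conjecture]`),
theorems; no sorries; standard axioms.

Level `0` of the conditioned slack hierarchy (MDL(X)): for owner `x`, avoided set `Y`, observers `o, v` and monotone `f` of the open edge
cluster of `x`, `covD(f, o) ≥ λ · covD(f, v)` (`covD = CSH.covD w x Y`, the denominator-free covariance under `D = {x ↮ Y}`).  KERNEL so far: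
the tree's `p = P(o ∈ C_v | v ↮ {x}∪Y)` is admissible (`CSH.cshMargin_nil_nonneg`); `p ≤ p̂ ≤ p⋆` (`Consts.jointObserverConst_ge`,
`Consts.jointObsConst_le_singleEdgeConst`) with `p̂ = P(o ∈ C_v | v ↮ {x}∪Y, x ↮ Y)` and the single-pair value
`p⋆ = [P(o ∈ C_x ∪ C_v | x ↮ Y, v ↮ Y) − P(o ∈ C_x | x ↮ Y)] / P(v ∉ C_x | x ↮ Y)`; every admissible `λ` is `≤ p⋆`
(`Consts.singleEdge_not_improvable`); `p⋆` is admissible against all competitors supported on `{v ∈ C_x}` (`Consts.singleEdge_margin_nonneg_of_support`)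
and admissible on `G` as soon as it is admissible on `G − xv` (`Consts.mdlx_of_pairDeleted`).

* `Consts.SingleEdgeExtremal` — **CONJECTURE SEE (OPEN)**: `p⋆` is admissible, i.e. for all data and every monotone `f`
  `covD(f, v) · [μ(D) μ(D₁ ∩ O) − μ(D₁) μ(D ∩ {x ↔ o})] ≤ covD(f, o) · [μ(D₁) μ(D ∩ {x ↮ v})]` (`D₁ = D ∩ {v ↮ Y}`, `O = {x ↔ o} ∪ {v ↔ o}`);
  equivalently the sharp constant `p_hi` of MDL(X) EQUALS `p⋆` on every finite weighted graph and is attained at `f = 1{s(x,v) ∈ 𝐂_x}`.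
  EVIDENCE (exact / two implementations): ttrl2 consts census n ≤ 6, all 2 772 level-0 placements with `Y ≠ ∅` × {½, grid7, iid20}: minimiser
  `↑{xv}` i.e. `p_hi = p⋆` in 2 772/2 772 (CONSTS.md 01:20Z, prim-paper-s3 g71/g72 second program); this seat: ≈ 90 000 random instances `n ≤ 7`
  beyond those palettes (uniform, sparse supports, near-degenerate weights; C engine `see.c` + exact cross-check, kit j116246) and adversarial
  hill-climbs: 0 violations.  The level-`k ≥ 1` analogue is FALSE (census: 25/5 760 exceptions, minimisers `1{T internally connected}`).
* `Consts.singleEdgeExtremal_of_isEmpty` — the `Y = ∅` instance HOLDS (there `p⋆ = p`; it is the tree's MDL(∅), `CovTau.markerDominanceAvoid`).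
* `Consts.SingleEdgeExtremal.admissible_iff` — under SEE, for non-degenerate weights: `λ` is admissible iff `λ ≤ p⋆` (denominator-free).
* `Consts.SingleEdgeExtremal.mdlxJoint` — **SEE ⟹ `Consts.MDLXJoint`** (via `p̂ ≤ p⋆`); with `Consts.mdlx_of_mdlxJoint`, SEE ⟹ MDL(X)′ ⟹ MDL(X).
[cite: VandenbergHaggstromKahn2005, Thm. 1.3 (p. 6), Thm. 1.4 (p. 7), §2.1 (pp. 9–13)] [cite: KozmaNitzan2024, Conj. 4 (p. 32)]
-/

noncomputable section

namespace Summit.CriticalPhenomena.PercolationContinuityZ3.Theorems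

open MeasureTheory Set Literature.Probability.LatticeModels Literature.Probability.Percolation
open scoped Classical

namespace Consts

/-- **CONJECTURE SEE — single-edge extremality of the MDL(X) observer constant (OPEN).**  For every finite weighted graph
(`Fin n`, weights `w`, `μ = prodBernoulli w`), owner `x`, avoided set `Y`, observers `o, v`, and every monotone functional `f` of the open edge
cluster of `x`: with `D = {x ↮ Y}`, `D₁ = {x ↮ Y} ∩ {v ↮ Y}`, `O = {x ↔ o} ∪ {v ↔ o}`,
`covD(f, v) · [μ(D) μ(D₁ ∩ O) − μ(D₁) μ(D ∩ {x ↔ o})] ≤ covD(f, o) · [μ(D₁) μ(D ∩ {x ↮ v})]` (`covD = CSH.covD w x Y f`), i.e. the level-0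
inequality of the conditioned slack hierarchy holds with the single-pair value `p⋆ = [P(o ∈ C_x ∪ C_v | x↮Y, v↮Y) − P(o ∈ C_x | x↮Y)] / P(v ∉ C_x | x↮Y)`
— by `Consts.singleEdge_not_improvable` the largest conceivable constant, attained at `f = 1{s(x,v) ∈ 𝐂_x}`.  (No side conditions are needed:
for `x ∈ Y`, `v ∈ Y` or `x = v` both sides vanish.)  KNOWN: `Y = ∅` (`Consts.singleEdgeExtremal_of_isEmpty`); all `f` supported on `{v ∈ C_x}`
(`Consts.singleEdge_margin_nonneg_of_support`); reduction to graphs with `w_{xv} = 0` (`Consts.mdlx_of_pairDeleted`).  OPEN in general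
(this programme, PAPER-2 consts track, 2026-08-21; exact census n ≤ 6: 2 772/2 772; ≈ 90 000 random instances n ≤ 7: 0 violations; the
decoy-level analogue is false). [cite: VandenbergHaggstromKahn2005, §2.1 (pp. 9–13)] [status: open] -/
@[conjecture] def SingleEdgeExtremal : Prop :=
  ∀ (n : ℕ) (w : Sym2 (Fin n) → unitInterval) (x o v : Fin n) (Y : Set (Fin n)) (f : Set (Sym2 (Fin n)) → ℝ), Monotone f →
    CSH.covD w x Y f v *
        ((prodBernoulli w).real {ω : BondConfig (Fin n) | ∀ y ∈ Y, ¬ (openGraph ω).Reachable x y} *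
            (prodBernoulli w).real
              ({ω : BondConfig (Fin n) | ∀ y ∈ Y, ¬ (openGraph ω).Reachable x y ∧ ¬ (openGraph ω).Reachable v y} ∩
                (openConn x o ∪ openConn v o)) -
          (prodBernoulli w).real
              {ω : BondConfig (Fin n) | ∀ y ∈ Y, ¬ (openGraph ω).Reachable x y ∧ ¬ (openGraph ω).Reachable v y} *
            (prodBernoulli w).real ({ω : BondConfig (Fin n) | ∀ y ∈ Y, ¬ (openGraph ω).Reachable x y} ∩ openConn x o)) ≤
      CSH.covD w x Y f o *
        ((prodBernoulli w).real
            {ω : BondConfig (Fin n) | ∀ y ∈ Y, ¬ (openGraph ω).Reachable x y ∧ ¬ (openGraph ω).Reachable v y} *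
          (prodBernoulli w).real
            ({ω : BondConfig (Fin n) | ∀ y ∈ Y, ¬ (openGraph ω).Reachable x y} ∩ {ω | ¬ (openGraph ω).Reachable x v}))

/-- **The `Y = ∅` instance of SEE holds.**  With no avoided set `D = D₁ = univ`, `μ(O) − μ({x ↔ o}) = μ(v ↔ o, v ↮ x)` and
`μ({x ↮ v}) = μ(v ↮ x)`, so the inequality is the tree's MDL(∅) (`CovTau.markerDominanceAvoid` at `X = ∅`): `p⋆ = p = P(o ∈ C_v | v ∉ C_x)`.
[cite: VandenbergHaggstromKahn2005, Thm. 1.3 (p. 6)] -/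
theorem singleEdgeExtremal_of_isEmpty {V : Type*} [Fintype V] (w : Sym2 V → unitInterval) (x o v : V) (f : Set (Sym2 V) → ℝ)
    (hf : Monotone f) :
    CSH.covD w x ∅ f v *
        ((prodBernoulli w).real {ω : BondConfig V | ∀ y ∈ (∅ : Set V), ¬ (openGraph ω).Reachable x y} *
            (prodBernoulli w).real
              ({ω : BondConfig V | ∀ y ∈ (∅ : Set V), ¬ (openGraph ω).Reachable x y ∧ ¬ (openGraph ω).Reachable v y} ∩
                (openConn x o ∪ openConn v o)) -
          (prodBernoulli w).real
              {ω : BondConfig V | ∀ y ∈ (∅ : Set V), ¬ (openGraph ω).Reachable x y ∧ ¬ (openGraph ω).Reachable v y} *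
            (prodBernoulli w).real ({ω : BondConfig V | ∀ y ∈ (∅ : Set V), ¬ (openGraph ω).Reachable x y} ∩ openConn x o)) ≤
      CSH.covD w x ∅ f o *
        ((prodBernoulli w).real
            {ω : BondConfig V | ∀ y ∈ (∅ : Set V), ¬ (openGraph ω).Reachable x y ∧ ¬ (openGraph ω).Reachable v y} *
          (prodBernoulli w).real
            ({ω : BondConfig V | ∀ y ∈ (∅ : Set V), ¬ (openGraph ω).Reachable x y} ∩ {ω | ¬ (openGraph ω).Reachable x v})) := by
  classical
  set μ := prodBernoulli w with hμ
  have hmeas : ∀ U : Set (BondConfig V), MeasurableSet U := fun _ => MeasurableSet.of_discrete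
  have hD : {ω : BondConfig V | ∀ y ∈ (∅ : Set V), ¬ (openGraph ω).Reachable x y} = Set.univ := by ext ω; simp
  have hD₁ : {ω : BondConfig V | ∀ y ∈ (∅ : Set V), ¬ (openGraph ω).Reachable x y ∧ ¬ (openGraph ω).Reachable v y} = Set.univ := by
    ext ω; simp
  by_cases hxv : x = v
  · -- degenerate: `{x ↮ x} = ∅`, and `covD(f, x) = 0`
    subst hxv
    have hN : ({ω : BondConfig V | ¬ (openGraph ω).Reachable x x} : Set (BondConfig V)) = ∅ := by
      ext ω; simp only [mem_setOf_eq, mem_empty_iff_false, iff_false, not_not]; exact SimpleGraph.Reachable.refl _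
    have hcov : CSH.covD w x ∅ f x = 0 := by
      unfold CSH.covD
      have hA : (openConn x x : Set (BondConfig V)) = Set.univ := by
        ext ω; simp only [mem_univ, iff_true]; exact SimpleGraph.Reachable.refl _
      rw [hA, Set.inter_univ]; ring
    simp only [hN, Set.inter_empty, measureReal_empty, mul_zero, hcov, zero_mul, le_refl]
  -- `x ≠ v`: MDL(∅)
  have key := CovTau.markerDominanceAvoid w x v o (∅ : Set V) hxv f hf
  set 𝒜 : Set (BondConfig V) := {ω | ∀ a ∈ insert x (∅ : Set V), ¬ (openGraph ω).Reachable v a} with h𝒜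
  have h𝒜N : ({ω : BondConfig V | ¬ (openGraph ω).Reachable x v} : Set (BondConfig V)) = 𝒜 := by
    ext ω
    simp only [h𝒜, mem_setOf_eq, mem_insert_iff, mem_empty_iff_false, or_false, forall_eq]
    exact ⟨fun h h' => h h'.symm, fun h h' => h h'.symm⟩
  -- `μ(O) − μ({x ↔ o}) = μ(𝒜 ∩ {v ↔ o})`
  have hOA : μ.real (openConn x o ∪ openConn v o) - μ.real (openConn x o : Set (BondConfig V)) = μ.real (𝒜 ∩ openConn v o) := by
    have hdisj : Disjoint (openConn x o : Set (BondConfig V)) (𝒜 ∩ openConn v o) := by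
      rw [Set.disjoint_left]
      intro ω hxo h
      have hvx : ¬ (openGraph ω).Reachable v x := by
        have := h.1 x (mem_insert x ∅); exact this
      exact hvx ((show (openGraph ω).Reachable v o from h.2).trans (show (openGraph ω).Reachable x o from hxo).symm)
    have hunion : (openConn x o ∪ openConn v o : Set (BondConfig V)) = openConn x o ∪ (𝒜 ∩ openConn v o) := by
      ext ω
      simp only [mem_union, mem_inter_iff, h𝒜, mem_setOf_eq, mem_insert_iff, mem_empty_iff_false, or_false, forall_eq]
      constructor
      · rintro (h | h)
        · exact Or.inl h
        · by_cases hxo : ω ∈ openConn x o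
          · exact Or.inl hxo
          · exact Or.inr ⟨fun hvx => hxo (show (openGraph ω).Reachable x o from hvx.symm.trans h), h⟩
      · rintro (h | ⟨-, h⟩)
        · exact Or.inl h
        · exact Or.inr h
    rw [hunion, measureReal_union hdisj (hmeas _)]
    ring
  unfold CSH.covD
  rw [hD] at key
  rw [hD, hD₁]
  simp only [Set.univ_inter, probReal_univ, Measure.restrict_univ, one_mul] at key ⊢
  rw [hOA, h𝒜N]
  exact (mul_comm _ _).trans_le (key.trans_eq (mul_comm _ _))

variable {V : Type*} [Fintype V]

/-- **Under SEE, `λ` is admissible iff `λ ≤ p⋆`** (non-degenerate weights, `x ≠ v`, `x, v ∉ Y`; both sides denominator-free).  `→` is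
`Consts.singleEdge_not_improvable` (test `f = 1{s(x,v) ∈ ·}`); `←` multiplies SEE by `λ ≤ p⋆` using `covD(f, v) ≥ 0`
(`Consts.covD_conn_nonneg`). [cite: VandenbergHaggstromKahn2005, Thm. 1.3 (p. 6)] -/
theorem SingleEdgeExtremal.admissible_iff (hSEE : SingleEdgeExtremal) {n : ℕ} (w : Sym2 (Fin n) → unitInterval)
    (hw : ∀ d, 0 < w d ∧ w d < 1) (x o v : Fin n) (Y : Set (Fin n)) (hxv : x ≠ v) (hx : x ∉ Y) (hv : v ∉ Y) (lam : ℝ) :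
    (∀ f : Set (Sym2 (Fin n)) → ℝ, Monotone f → 0 ≤ CSH.covD w x Y f o - lam * CSH.covD w x Y f v) ↔
      lam * ((prodBernoulli w).real
              {ω : BondConfig (Fin n) | ∀ y ∈ Y, ¬ (openGraph ω).Reachable x y ∧ ¬ (openGraph ω).Reachable v y} *
            (prodBernoulli w).real
              ({ω : BondConfig (Fin n) | ∀ y ∈ Y, ¬ (openGraph ω).Reachable x y} ∩ {ω | ¬ (openGraph ω).Reachable x v})) ≤
        (prodBernoulli w).real {ω : BondConfig (Fin n) | ∀ y ∈ Y, ¬ (openGraph ω).Reachable x y} *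
            (prodBernoulli w).real
              ({ω : BondConfig (Fin n) | ∀ y ∈ Y, ¬ (openGraph ω).Reachable x y ∧ ¬ (openGraph ω).Reachable v y} ∩
                (openConn x o ∪ openConn v o)) -
          (prodBernoulli w).real
              {ω : BondConfig (Fin n) | ∀ y ∈ Y, ¬ (openGraph ω).Reachable x y ∧ ¬ (openGraph ω).Reachable v y} *
            (prodBernoulli w).real ({ω : BondConfig (Fin n) | ∀ y ∈ Y, ¬ (openGraph ω).Reachable x y} ∩ openConn x o) := by
  classical
  set μ := prodBernoulli w with hμ
  set M : ℝ := μ.real {ω : BondConfig (Fin n) | ∀ y ∈ Y, ¬ (openGraph ω).Reachable x y ∧ ¬ (openGraph ω).Reachable v y} *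
      μ.real ({ω : BondConfig (Fin n) | ∀ y ∈ Y, ¬ (openGraph ω).Reachable x y} ∩ {ω | ¬ (openGraph ω).Reachable x v}) with hM
  set R : ℝ := μ.real {ω : BondConfig (Fin n) | ∀ y ∈ Y, ¬ (openGraph ω).Reachable x y} *
      μ.real ({ω : BondConfig (Fin n) | ∀ y ∈ Y, ¬ (openGraph ω).Reachable x y ∧ ¬ (openGraph ω).Reachable v y} ∩
        (openConn x o ∪ openConn v o)) -
    μ.real {ω : BondConfig (Fin n) | ∀ y ∈ Y, ¬ (openGraph ω).Reachable x y ∧ ¬ (openGraph ω).Reachable v y} *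
      μ.real ({ω : BondConfig (Fin n) | ∀ y ∈ Y, ¬ (openGraph ω).Reachable x y} ∩ openConn x o) with hR
  constructor
  · intro h
    exact singleEdge_not_improvable w hw x o v Y hxv hx hv lam (h _ (by
      intro C C' hCC'
      dsimp only
      split_ifs with h1 h2
      · exact le_rfl
      · exact absurd (hCC' h1) h2
      · exact zero_le_one
      · exact le_rfl))
  · intro hlam f hf
    have hS := hSEE n w x o v Y f hf
    have hcv : 0 ≤ CSH.covD w x Y f v := covD_conn_nonneg w x Y hx f hf v
    -- `M > 0`: the empty configuration lies in both events
    have hlt : ∀ d, w d < 1 := fun d => (hw d).2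
    have hbot : openGraph (∅ : BondConfig (Fin n)) = ⊥ := by
      unfold openGraph; exact SimpleGraph.fromEdgeSet_empty
    have hnoreach : ∀ a b : Fin n, a ≠ b → ¬ (openGraph (∅ : BondConfig (Fin n))).Reachable a b := fun a b hab h => by
      rw [hbot, SimpleGraph.reachable_bot] at h; exact hab h
    have hMpos : 0 < M :=
      mul_pos (CSH.prodBernoulli_real_pos_of_empty_mem w hlt (fun y hy =>
          ⟨hnoreach x y (fun h => hx (h ▸ hy)), hnoreach v y (fun h => hv (h ▸ hy))⟩))
        (CSH.prodBernoulli_real_pos_of_empty_mem w hlt ⟨fun y hy => hnoreach x y (fun h => hx (h ▸ hy)), hnoreach x v hxv⟩)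
    -- `lam · covD_v · M ≤ covD_v · R ≤ covD_o · M`
    have h1 : lam * CSH.covD w x Y f v * M ≤ CSH.covD w x Y f v * R := by
      have := mul_le_mul_of_nonneg_left hlam hcv
      linarith
    have h2 : CSH.covD w x Y f v * R ≤ CSH.covD w x Y f o * M := hS
    have h3 : (lam * CSH.covD w x Y f v) * M ≤ CSH.covD w x Y f o * M := by linarith
    have := le_of_mul_le_mul_right h3 hMpos
    linarith

/-- **SEE ⟹ MDL(X)′ (`Consts.MDLXJoint`)**: single-edge extremality makes `p⋆` admissible, and `p̂ ≤ p⋆`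
(`Consts.jointObsConst_le_singleEdgeConst`), so the jointly-conditioned constant `p̂` is admissible too (using `covD(f, v) ≥ 0`).
With `Consts.mdlx_of_mdlxJoint` the chain SEE ⟹ MDL(X)′ ⟹ MDL(X) is kernel-checked. [cite: VandenbergHaggstromKahn2005, Thm. 1.3 (p. 6), Thm. 1.4 (p. 7)] -/
theorem SingleEdgeExtremal.mdlxJoint (hSEE : SingleEdgeExtremal) : MDLXJoint := by
  classical
  intro n w s y z X hsy F hF
  set μ := prodBernoulli w with hμ
  set D : Set (BondConfig (Fin n)) := {ω | ∀ x ∈ X, ¬ (openGraph ω).Reachable s x} with hD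
  set D₁ : Set (BondConfig (Fin n)) := {ω | ∀ x ∈ X, ¬ (openGraph ω).Reachable s x ∧ ¬ (openGraph ω).Reachable y x} with hD₁
  set 𝒜 : Set (BondConfig (Fin n)) := {ω | ∀ x ∈ insert s X, ¬ (openGraph ω).Reachable y x} with h𝒜
  set N : Set (BondConfig (Fin n)) := {ω | ¬ (openGraph ω).Reachable s y} with hN
  set M : ℝ := μ.real D₁ * μ.real (D ∩ N) with hM
  set R : ℝ := μ.real D * μ.real (D₁ ∩ (openConn s z ∪ openConn y z)) - μ.real D₁ * μ.real (D ∩ openConn s z) with hR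
  -- SEE at `(x, o, v, Y) := (s, z, y, X)` and `p̂ ≤ p⋆`
  have hS : CSH.covD w s X F y * R ≤ CSH.covD w s X F z * M := hSEE n w s z y X F hF
  have hJ : μ.real (𝒜 ∩ D ∩ openConn y z) * M ≤ μ.real (𝒜 ∩ D) * R := jointObsConst_le_singleEdgeConst w s z y X
  -- the goal, in `CSH.covD` form
  show μ.real (𝒜 ∩ D ∩ openConn y z) * CSH.covD w s X F y ≤ μ.real (𝒜 ∩ D) * CSH.covD w s X F z
  have hsX : s ∉ X ∨ s ∈ X := em' (s ∈ X)
  rcases hsX with hsX | hsX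
  swap
  · -- degenerate: `s ∈ X` makes `D = ∅`
    have hD0 : D = ∅ := by
      ext ω; simp only [hD, mem_setOf_eq, mem_empty_iff_false, iff_false, not_forall, not_not]
      exact ⟨s, hsX, SimpleGraph.Reachable.refl _⟩
    have h0 : μ.real (𝒜 ∩ D ∩ openConn y z) = 0 := by rw [hD0, Set.inter_empty, Set.empty_inter, measureReal_empty]
    have h0' : μ.real (𝒜 ∩ D) = 0 := by rw [hD0, Set.inter_empty, measureReal_empty]
    rw [h0, h0']; simp
  have hcv : 0 ≤ CSH.covD w s X F y := covD_conn_nonneg w s X hsX F hF y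
  have h𝒜D0 : 0 ≤ μ.real (𝒜 ∩ D) := measureReal_nonneg
  by_cases hMz : M = 0
  · -- degenerate: `μ(D₁) μ(D ∩ N) = 0` forces `μ(𝒜 ∩ D) = 0`
    have hsub1 : 𝒜 ∩ D ⊆ D₁ := by
      rintro ω ⟨h𝒜ω, hDω⟩ x hx
      exact ⟨hDω x hx, h𝒜ω x (mem_insert_of_mem s hx)⟩
    have hsub2 : 𝒜 ∩ D ⊆ D ∩ N := by
      rintro ω ⟨h𝒜ω, hDω⟩
      exact ⟨hDω, fun h => h𝒜ω s (mem_insert s X) h.symm⟩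
    have hzero : μ.real (𝒜 ∩ D) = 0 := by
      rcases mul_eq_zero.1 hMz with h | h
      · exact le_antisymm (h ▸ measureReal_mono hsub1) measureReal_nonneg
      · exact le_antisymm (h ▸ measureReal_mono hsub2) measureReal_nonneg
    have hzero' : μ.real (𝒜 ∩ D ∩ openConn y z) = 0 :=
      le_antisymm (hzero ▸ measureReal_mono inter_subset_left) measureReal_nonneg
    rw [hzero, hzero']; simp
  have hMpos : 0 < M := lt_of_le_of_ne (mul_nonneg measureReal_nonneg measureReal_nonneg) (Ne.symm hMz)
  -- chain: `E · covD_y · M ≤ μ(𝒜D) · R · covD_y ≤ μ(𝒜D) · covD_z · M`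
  have h1 : μ.real (𝒜 ∩ D ∩ openConn y z) * CSH.covD w s X F y * M ≤ μ.real (𝒜 ∩ D) * (CSH.covD w s X F y * R) := by
    have := mul_le_mul_of_nonneg_right hJ hcv
    linarith
  have h2 : μ.real (𝒜 ∩ D) * (CSH.covD w s X F y * R) ≤ μ.real (𝒜 ∩ D) * (CSH.covD w s X F z * M) :=
    mul_le_mul_of_nonneg_left hS h𝒜D0
  have h3 : (μ.real (𝒜 ∩ D ∩ openConn y z) * CSH.covD w s X F y) * M ≤ (μ.real (𝒜 ∩ D) * CSH.covD w s X F z) * M := by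
    have := h1.trans h2
    linarith
  exact le_of_mul_le_mul_right h3 hMpos

end Consts

end Summit.CriticalPhenomena.PercolationContinuityZ3.Theorems

end
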